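import Mathlib
import HarnessLib
import Summits.KontsevichZagierPeriods.Zeta5Search.VWPInduction
import Summits.KontsevichZagierPeriods.Zeta5Search.VWPOfReal

/-!
# ζ(5) search — Zudilin's Theorem (4) for positive real parameters: the named fact `vwp_eq_integral_of_pos` PROVED
(cell `pub-zeta5`, ct-1 g28)

HONEST FRAMING: systematic search; no irrationality claim unless kernel-certified.  An identity of special functions (a
very-well-poised `ₖ₊₄F_{k+3}(±1)` series = a Sorokin-type multiple integral); nothing here is an irrationality result, a worthiness
exponent or a denominator statement; no definition is introduced.  This file DISCHARGES the Literature named fact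
`Literature.NumberTheory.Irrationality.Zudilin2002.vwp_eq_integral_of_pos` [Zudilin, math/0206177, Theorem, eq. (4) under (5)–(6),
positive-parameter case] — every cell file carrying `(hZ : vwp_eq_integral_of_pos)` becomes unconditional by feeding
`vwp_eq_integral_of_pos_holds`.

Brick B7 of `HOME/ct-1/g28/VWP-BLUEPRINT-g28.md`: restrict the complex-parameter identity `VWPInduction.identity` (all `k ≥ 1`,
proved along the corrected route: first-variable Barnes step at large real `h₀` + identity theorem in `h₀`) to `h ↦ (h_n : ℂ)` and
identify both sides with the casts of the typed real `vwpSeries` / `sorokinIntegral` (`VWPOfReal`).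

* **`vwp_eq_integral_of_pos_holds : vwp_eq_integral_of_pos`**.

Theorems only; imports `VWPInduction`, `VWPOfReal`.
-/

noncomputable section

namespace Summit.KontsevichZagierPeriods.Zeta5Search.VWPOfPos

open MeasureTheory Set
open Literature.NumberTheory.Irrationality.Zudilin2002 (nestedQ sorokinIntegral vwpSeries vwp_eq_integral_of_pos)
open Summit.KontsevichZagierPeriods.Zeta5Search.VWPInduction (identity)
open Summit.KontsevichZagierPeriods.Zeta5Search.VWPOfReal (setIntegral_ofReal vwpSeries_ofReal)

/-- **Zudilin's Theorem [math/0206177, eq. (4) with (5)–(6)] for positive real parameters — the named fact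
`vwp_eq_integral_of_pos` holds**: for `k ≥ 1` and real `h` with `(2/(k+1))Σ_{j=1}^{k+2}h_j < 1+h₀`, `0 < h_j < 1+h₀−h_{j+1}`
(`2 ≤ j ≤ k+1`), `h₀, h₁, h_{k+2} > 0`, `h₁+h₂ < 1+h₀`,
`(∏_{j=1}^{k+1}Γ(1+h₀−h_j−h_{j+1}))/(Γ(h₁)Γ(h_{k+2})) · F_{k+2}(h) = J_k(h₁; h₂,…,h_{k+1} | 1+h₀−h₃,…,1+h₀−h_{k+2})`. -/
theorem vwp_eq_integral_of_pos_holds : vwp_eq_integral_of_pos := by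
  intro k h hk h5 h6 hh0 hh1 hk2 h12
  -- the complex-parameter identity at `g_n = (h_n : ℂ)`
  have hid := identity hk (fun n => ((h n : ℝ) : ℂ)) (by simpa only [Complex.ofReal_re] using h5)
    (by simpa only [Complex.ofReal_re] using h6) (by simpa only [Complex.ofReal_re] using hh0)
    (by simpa only [Complex.ofReal_re] using hh1) (by simpa only [Complex.ofReal_re] using hk2)
    (by simpa only [Complex.ofReal_re] using h12)
  -- the integral side is the cast of the typed `J_k`
  have hR : (∫ x in Set.pi univ (fun _ : Fin k => Icc (0 : ℝ) 1),
      (∏ j : Fin k, ((x j : ℝ) : ℂ) ^ ((fun n => ((h n : ℝ) : ℂ)) (j + 2) - 1) *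
          (1 - ((x j : ℝ) : ℂ)) ^ ((1 + (fun n => ((h n : ℝ) : ℂ)) 0 - (fun n => ((h n : ℝ) : ℂ)) (j + 3)) -
            (fun n => ((h n : ℝ) : ℂ)) (j + 2) - 1)) *
        ((nestedQ (List.ofFn x) : ℝ) : ℂ) ^ (-(fun n => ((h n : ℝ) : ℂ)) 1)) =
      ((sorokinIntegral k (h 1) (fun i => h (i + 2)) (fun i => 1 + h 0 - h (i + 3)) : ℝ) : ℂ) := by
    rw [← setIntegral_ofReal]
    refine setIntegral_congr_fun (MeasurableSet.univ_pi fun _ => measurableSet_Icc) fun x _ => ?_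
    simp only [Complex.ofReal_add, Complex.ofReal_sub, Complex.ofReal_one]
  -- the series side is the cast of the typed `F_{k+2}`
  have hS : (∑' μ : ℕ, ((fun n => ((h n : ℝ) : ℂ)) 0 + 2 * (μ : ℂ)) *
      (∏ i ∈ Finset.range (k + 3), Complex.Gamma ((fun n => ((h n : ℝ) : ℂ)) i + μ) /
        Complex.Gamma (1 + (fun n => ((h n : ℝ) : ℂ)) 0 - (fun n => ((h n : ℝ) : ℂ)) i + μ)) * (-1 : ℂ) ^ ((k + 3) * μ)) =
      ((vwpSeries (k + 2) h : ℝ) : ℂ) := vwpSeries_ofReal (k + 2) h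
  -- the Gamma prefactor is the cast of the real one
  have hΓ : ∀ r : ℝ, ((Real.Gamma r : ℝ) : ℂ) = Complex.Gamma (r : ℂ) := fun r => (Complex.Gamma_ofReal r).symm
  have hP : (∏ i ∈ Finset.Icc 1 (k + 1), Complex.Gamma (1 + (fun n => ((h n : ℝ) : ℂ)) 0 - (fun n => ((h n : ℝ) : ℂ)) i -
        (fun n => ((h n : ℝ) : ℂ)) (i + 1))) /
      (Complex.Gamma ((fun n => ((h n : ℝ) : ℂ)) 1) * Complex.Gamma ((fun n => ((h n : ℝ) : ℂ)) (k + 2))) =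
      ((((∏ j ∈ Finset.Icc 1 (k + 1), Real.Gamma (1 + h 0 - h j - h (j + 1))) / (Real.Gamma (h 1) * Real.Gamma (h (k + 2))) : ℝ) : ℂ)) := by
    push_cast
    simp_rw [hΓ]
    push_cast
    rfl
  apply Complex.ofReal_injective
  rw [Complex.ofReal_mul, ← hP, ← hS, ← hR]
  exact hid

end Summit.KontsevichZagierPeriods.Zeta5Search.VWPOfPos

end
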